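import Literature.NumberTheory.Automorphic.IrreducibleClasses
import HarnessLib

/-!
# Unitarizable classes of irreducible smooth representations (`IrrClass.IsUnitarizable`)

Topic `NumberTheory/Automorphic`; namespace `Literature.NumberTheory.Automorphic.IrrClass` (the home of ★ `IrrClass.HasCentralCharacter`,
`IrrClass.IsSupercuspidal` in `IrreducibleClasses`, and of ★ `IrrClass.IsAdmissible` ∕ `IrrClass.IsSpherical` in `HeckeEigencharacterPackage`).
ONE predicate with a body + its computation rules; no named fact, no instance, no notation, no `sorry`; import cone = ★ `IrreducibleClasses`
(which already brings ★ `Representation.IsUnitarizable` of `MatrixCoefficients`).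

THE MATHEMATICS.  A smooth representation `π` of `G` on a complex vector space is *unitarizable* when it carries a `G`-invariant
positive-definite Hermitian form (★ `Representation.IsUnitarizable`; Bushnell–Henniart (2006) §11.1; Rogawski (1990) §1.6 «unitary
representations»).  The notion is invariant under isomorphism of representations — transport the form along the isomorphism
(Bushnell–Henniart §11.1; ★ `Representation.IsUnitarizable.of_equiv` of `JacquetLanglandsTransfer`, re-proved below as a private
12-line helper so that this predicate file does not import the `GL₂`∕quaternion cone of that file) — hence DESCENDS to the isomorphism
classes `c ∈ Irr(G)` (★ `IrrClass`, ★ `IrrClass.liftProp`): `IrrClass.IsUnitarizable c`.  This is the class-level currency of the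
hypothesis «irreducible UNITARY representations» of the linear independence of characters (Rogawski (1990) Prop. 13.8.1 p. 206 =
[JL70] Lemma 16.1.1: «Let `X` be a countable set of irreducible unitary representations of a reductive group `G` …») and of the
unitarity of the local components of discrete automorphic representations (Rogawski §14.5; proved for the cell's definite unitary
groups in ★ `Summits/…/Theorems/F0P3LocalConstituentsUnitary`, whose heads conclude `∃ r, IrrClass.mk r = c ∧ r.ρ.IsUnitarizable` —
exactly `c.IsUnitarizable` by `isUnitarizable_iff_exists` below).

* `IrrClass.IsUnitarizable c` — the class consists of unitarizable representations;
* `isUnitarizable_mk` (simp) — `[r].IsUnitarizable ↔ r.ρ.IsUnitarizable`;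
* `isUnitarizable_iff_exists` — `c.IsUnitarizable ↔ ∃ r, IrrClass.mk r = c ∧ r.ρ.IsUnitarizable`; `IsUnitarizable.of_mk_eq` (the
  direction used to read an `∃ r`-shaped head as the predicate) and `IsUnitarizable.exists_rep`.

## References
* C. J. Bushnell, G. Henniart, *The Local Langlands Conjecture for GL(2)*, Grundlehren 335 (2006), §11.1.
* J. D. Rogawski, *Automorphic Representations of Unitary Groups in Three Variables*, Ann. of Math. Stud. 123 (1990), §1.6, Prop. 13.8.1 p. 206.
-/

set_option autoImplicit false

namespace Literature.NumberTheory.Automorphic.IrrClass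

universe u

variable {G : Type u} [Group G] [TopologicalSpace G]

omit [TopologicalSpace G] in
/-- Transport of unitarizability along an isomorphism of representations: the form `(w, w′) ↦ B (φ⁻¹ w) (φ⁻¹ w′)`.  (Same statement as ★
`Representation.IsUnitarizable.of_equiv` of `JacquetLanglandsTransfer`; re-proved privately to keep the import cone small.)
[cite: BushnellHenniart2006, §11.1] -/
private theorem isUnitarizable_transport {V W : Type} [AddCommGroup V] [Module ℂ V] [AddCommGroup W] [Module ℂ W]
    {ρ : Representation ℂ G V} {σ : Representation ℂ G W} (h : ρ.IsUnitarizable) (φ : ρ.Equiv σ) : σ.IsUnitarizable := by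
  obtain ⟨B, hB, hpos, hinv⟩ := h
  set e : W →ₗ[ℂ] V := (φ.symm.toLinearEquiv : W →ₗ[ℂ] V) with he
  have he' : ∀ (g : G) (w : W), e (σ g w) = ρ g (e w) := fun g w =>
    φ.symm.toIntertwiningMap.isIntertwining σ ρ g w
  refine ⟨(B.comp e).compl₂ e, ⟨fun x y => ?_⟩, fun x hx => ?_, fun g x y => ?_⟩
  · simp only [LinearMap.compl₂_apply, LinearMap.comp_apply]
    exact hB.eq _ _
  · simp only [LinearMap.compl₂_apply, LinearMap.comp_apply]
    refine hpos _ fun h0 => hx ?_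
    exact (map_eq_zero_iff _ φ.symm.toLinearEquiv.injective).1 h0
  · simp only [LinearMap.compl₂_apply, LinearMap.comp_apply]
    rw [he', he', hinv]

/-- **`c.IsUnitarizable` — the class `c ∈ Irr(G)` consists of unitarizable representations** (descent of ★ `Representation.IsUnitarizable`
along ★ `IrrClass.liftProp`; well defined by transport of the invariant positive-definite Hermitian form along isomorphisms,
Bushnell–Henniart §11.1).  The hypothesis «irreducible unitary representation» of Rogawski's Prop. 13.8.1, read on classes.
[cite: BushnellHenniart2006, §11.1] [cite: Rogawski1990, Prop. 13.8.1 p. 206] -/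
def IsUnitarizable (c : IrrClass G) : Prop :=
  liftProp (fun r : SmoothIrrep G => r.ρ.IsUnitarizable) (fun _ _ e h => isUnitarizable_transport h e) c

/-- Computation rule for `IsUnitarizable` on a class `[r]`. [cite: BushnellHenniart2006, §11.1] -/
@[simp] theorem isUnitarizable_mk (r : SmoothIrrep G) : (IrrClass.mk r).IsUnitarizable ↔ r.ρ.IsUnitarizable := Iff.rfl

/-- A class with a unitarizable representative is unitarizable (reads an `∃ r, IrrClass.mk r = c ∧ r.ρ.IsUnitarizable`-shaped conclusion, e.g.
the heads of ★ `F0P3LocalConstituentsUnitary`, as the predicate). [cite: BushnellHenniart2006, §11.1] -/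
theorem IsUnitarizable.of_mk_eq {r : SmoothIrrep G} {c : IrrClass G} (hc : IrrClass.mk r = c) (hr : r.ρ.IsUnitarizable) :
    c.IsUnitarizable := by
  subst hc
  exact (isUnitarizable_mk r).2 hr

/-- Every representative of a unitarizable class is unitarizable. [cite: BushnellHenniart2006, §11.1] -/
theorem IsUnitarizable.rep {c : IrrClass G} (h : c.IsUnitarizable) {r : SmoothIrrep G} (hc : IrrClass.mk r = c) :
    r.ρ.IsUnitarizable := by
  subst hc
  exact (isUnitarizable_mk r).1 h

/-- A unitarizable class has a unitarizable representative. [cite: BushnellHenniart2006, §11.1] -/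
theorem IsUnitarizable.exists_rep {c : IrrClass G} (h : c.IsUnitarizable) :
    ∃ r : SmoothIrrep G, IrrClass.mk r = c ∧ r.ρ.IsUnitarizable := by
  induction c using IrrClass.ind with
  | h r => exact ⟨r, rfl, (isUnitarizable_mk r).1 h⟩

/-- **`c.IsUnitarizable ↔ ∃ r, [r] = c ∧ r.ρ` unitarizable.** [cite: BushnellHenniart2006, §11.1] -/
theorem isUnitarizable_iff_exists (c : IrrClass G) :
    c.IsUnitarizable ↔ ∃ r : SmoothIrrep G, IrrClass.mk r = c ∧ r.ρ.IsUnitarizable :=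
  ⟨IsUnitarizable.exists_rep, fun ⟨_, hc, hr⟩ => IsUnitarizable.of_mk_eq hc hr⟩

end Literature.NumberTheory.Automorphic.IrrClass
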